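import Literature.MathematicalPhysics.QuantumFieldTheory.Balaban1983to89.Node00.RStepProvisosIntOfRecord
import Literature.MathematicalPhysics.QuantumFieldTheory.Balaban1983to89.Node00.Record12LiveSelectorTorus
import Literature.MathematicalPhysics.QuantumFieldTheory.Balaban1983to89.Node00.Record12MeasurabilityAtRecord

/-!
# NODE 00 — DEFINER ₇ (R-side), FILE 18: ROW P6 IN THE INTEGRABLE FORM (`Stage9Params.RStepInt`, FILE 17) AT THE STAGE-12 PARAMETERS OF RECORD —
# at `θ₀ = theta12OfRecord …` (identity selector) and at the LIVE RE-PIN `θ₀ˡⁱᵛᵉ = theta12LiveOfRecord …` (director-ym LINE №114 (α); seat K0a's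
# `Record12LiveSelector`) — from (H-U) `LocalBgMeasurable` ALONE

T. Bałaban, *Large field renormalization. I*, Commun. Math. Phys. **122** (1989) 175–202 [Balaban1989LargeFieldI] = [IV], (0.3)–(0.4) p. 176, p. 177;
*Convergent renormalization expansions …*, Commun. Math. Phys. **119** (1988) 243–285 [Balaban1988Convergent] = [III], (2.17)–(2.18) p. 257, (3.16) p. 268,
(3.22) p. 269, (3.24)–(3.25) p. 270.  Cell `pub-ymgap`, seat `pub-ymgap-node00-def-R` g8 (K0′ = `Record12Inhabited` = stmt-QuantumFields-19902, row P6 of the K0′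
component ledger).  FILE 17 = `Node00/RStepProvisosIntOfRecord` (`RepData.ProvisosInt`, `Stage9Params.RStepInt`, `Stage9Params.rstepInt_of_localBg_of_sel`);
K0a = `Node00/Record12LiveSelector` (`LiveSeq`, `liveSelOfSlot`, `ppSelLiveOfRecord`, `Stage12Params.liveRepin`, `theta12LiveOfRecord`) and
`Node00/Record12LiveSelectorTorus` (`liveSeq_of_ne_zero`); K0b = `Node00/Record12Residuals` (`zeta316OfRecord`, `Stage12Params.HasResidualsOfRecord`); K0c =
`Node00/Record12Measurability` ∕ `…AnySelector` ∕ `…AtRecord` ((H-U) `LocalBgMeasurable`, `zetaMeasurable_zeta316OfRecord_of_localBg`) and FILE 6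
`Node00/Record12MeasurabilityAtLiveRecord` (p480913: the `Provisos₁₀` ∕ `Provisos₁₂` ∕ K0′-body assembly at θ₀ˡⁱᵛᵉ with row P6 in the KEYED support form
DISPLAYED — its header names THIS file as the one declarer of row P6 in the integrable form at θ₀ ∕ θ₀ˡⁱᵛᵉ); K0e = `Node00/Record12Numerics` (`theta12OfRecord`).

CITATION HEADER (verbatim, [IV] p. 176): (0.3) *«(ℝρ)(V) = Σ_Z ρ(Z″, V) ∫dV⌈_{Z′}ρ(Z, V) ∕ ∫dV⌈_{Z′}ρ(Z″, V)»*; *«the densities are positive, and the integration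
domains in the integrals above are nonempty, hence the denominators are positive»*; (0.4) *«It satisfies the basic normalization property ∫dV(𝐑ρ)(V) = ∫dVρ(V).»*;
p. 177: *«the actual procedure is more complicated»* (the choice `Z ↦ Z″` is residual data: def-R's `PpSelOfRecord`).

WHY.  FILE 17 §6 proved `θ.RStepInt` — the text of row P6 `Provisos₁₀.rstep` with n10-b's pointwise `.ProvisosSupp` replaced by the integrable form
`.ProvisosInt` — at every `θ : Stage9Params` whose `p–p′` selector MOVES ONLY DEAD SEQUENCES, from (H-U), (H-ζ), the ζ-size law and the sign law `0 ≤ ζ`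
(`Stage9Params.rstepInt_of_localBg_of_sel`).  The K0′ witnesses of record are Stage-12 parameters: K0e's `θ₀ = theta12OfRecord F N ζ Rz Zt` (identity selector,
`theta12OfRecord_ppSel`) and, after director-ym's LINE №114 (α), K0a's LIVE RE-PIN `θ₀ˡⁱᵛᵉ = theta12LiveOfRecord F N ζ Rz Zt = θ₀.liveRepin` whose selector at
level `k + 1` is the live selector of the pre-𝐑 family there (`ppSelLiveOfRecord_succ_eq`): the identity on K0a's LIVE sequences (`LiveSeq`: at some `V` the
slot AND its own fibre integral `∫dV⌈_{Z′(s)} χ_{k+1}(s)·(𝐓ρ_k)(s)` are non-zero), every other sequence collapsed onto a live one.  A sequence that is NOT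
live is DEAD in FILE 17's sense — at every `V`, `(𝐓ρ_k)(s)(V) = 0` or `∫dV⌈_{Z′(s)} χ_{k+1}(s)·(𝐓ρ_k)(s) = 0 at V` (contrapositive of K0a's bridge
`liveSeq_of_ne_zero`) — so the live selector of record is of FILE 17's kind, and at both witnesses the (H-ζ) ∕ size ∕ sign laws are K0b's theorems about
`zeta316OfRecord` (K0c's `zetaMeasurable_zeta316OfRecord_of_localBg`, K0b's `isZetaAbsLeOne_zeta316OfRecord` ∕ `zeta316OfRecord_nonneg`).  THIS FILE records the
junction, BY NAME:

* §1 `Stage12Params.zeta_nonneg_of_hasResidualsOfRecord`, `Stage12Params.zetaMeasurable_of_localBg_of_hasResidualsOfRecord` (the two ζ-inputs of FILE 17 §6 at a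
  parameter carrying K0b's residuals of record, from (H-U)); **`Stage12Params.rstepInt_of_localBg_of_residuals`** — ROW P6 (integrable form) at a Stage-12
  parameter with the IDENTITY selector and the residuals of record, from (H-U) alone (K0c's `provisos₁₀_of_localBg_of_residuals` idiom: same `hsel`, `hU`, `hres`).
* §2 **`ppSelLiveOfRecord_fixed_or_dead`** — K0a's live selector of record, at every positive level, FIXES a sequence or the sequence is DEAD (FILE 17's
  dichotomy, generic in the numerics, normalisations and step weights); **`Stage9Params.rstepInt_of_localBg_liveSel`** (any `θ : Stage9Params` whose selector IS
  the live selector of record at its own data); **`Stage12Params.rstepInt_liveRepin_of_localBg`** — ROW P6 (integrable form) AT THE LIVE RE-PIN `θ.liveRepin`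
  of ANY Stage-12 parameter, from (H-U) ∧ (H-ζ) ∧ |ζ| ≤ 1 ∧ 0 ≤ ζ; `Stage12Params.rstepInt_liveRepin_of_localBg_of_residuals` (the same from (H-U) at K0b's
  residuals).
* §3 THE PINS: **`rstepInt_theta12OfRecord`** and **`rstepInt_theta12LiveOfRecord`** — at K0b's ζ of record `zeta316OfRecord F N numerics7OfRecord₁₂ 1 1` and ANY
  residual objects `Rz`, `Zt`, both witnesses satisfy row P6 in the integrable form under (H-U) `LocalBgMeasurable F N numerics7OfRecord₁₂` ALONE (rows P1∕P2∕P3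
  there are K0c's `intPiece_of_localBg_anySel` ∕ `measω_of_localBg` ∕ `measChi_of_localBg` under the same hypothesis; row P6 AS KEYED — the pointwise support
  form — stays LOCATED-OPEN by design, FILE 17's header).

## HONEST FRAMING — what this is NOT

* Kernel lemmas composing FILE 17 with K0a ∕ K0b ∕ K0c by name; nothing of Bałaban's asserted (no proviso, no (1.1)–(1.80) estimate, no shape law); NO record
  is restated or edited (`Provisos₁₀.rstep` ∕ `Provisos₁₂.base` stay keyed in the support form; whether a successor record keys `RStepInt` is def-T's ∕ the
  plan owner's call); no field of `Provisos₁₂` is inhabited at `N ≥ 2`; K0′ is NOT discharged; (H-U) stays a DISPLAYED hypothesis (K0c g2: a theorem only for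
  the measurable-selection carrier `bgSelOfRecord`, not for the `bgOfRecord` these records read); no node count moves (typed 28∕28 · discharged 5∕28).
* One finite four-torus programme at fixed `ε = L^{−K}` — NOT the continuum limit on ℝ⁴, NOT infinite volume, NOT OS, NOT a mass gap, NOT the Clay problem.
  No `sorry` ∕ `axiom` ∕ `opaque` ∕ `instance` ∕ `notation`.
-/

open _root_.MeasureTheory

namespace Literature.MathematicalPhysics.QuantumFieldTheory.Balaban1983to89.Node00

open T4Continuum B14.Eq218Concrete B15RopTotal FlowStep FlowStepRuns
open B15.BasicStep (fibreIntegral)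

variable (F : T4Family) (N : ℕ) [NeZero N]

/-! ## §1. The ζ-inputs at a parameter carrying the residuals of record; row P6 (integrable form) at the identity selector -/

section Residuals

variable {F N}

/-- **The sign law `0 ≤ ζ` at a parameter carrying K0b's residuals of record** (`θ.ζ = zeta316OfRecord …`, K0b's `zeta316OfRecord_nonneg`).
[cite: Balaban1988Convergent, (3.16) p.268 (bookkeeping)] -/
theorem Stage12Params.zeta_nonneg_of_hasResidualsOfRecord {θ : Stage12Params F N} (hres : θ.HasResidualsOfRecord F N) :
    ∀ p g k s Pl Ql RS U V', 0 ≤ θ.ζ p g k s Pl Ql RS U V' := by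
  rw [hres.zeta_eq]
  exact fun p g k s Pl Ql RS U V' => zeta316OfRecord_nonneg θ.A₁ p g k s Pl Ql RS U V'

/-- **(H-ζ) at a parameter carrying K0b's residuals of record, from (H-U)** (K0c's `zetaMeasurable_zeta316OfRecord_of_localBg`, by name).
[cite: Balaban1988Convergent, (3.3) p.265, (3.16) p.268 (bookkeeping)] -/
theorem Stage12Params.zetaMeasurable_of_localBg_of_hasResidualsOfRecord {θ : Stage12Params F N} (hU : LocalBgMeasurable F N θ.ν)
    (hres : θ.HasResidualsOfRecord F N) : ZetaMeasurable F N θ.ζ := by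
  rw [hres.zeta_eq]
  exact zetaMeasurable_zeta316OfRecord_of_localBg hU θ.τ9.M θ.A₁

/-- **ROW P6 IN THE INTEGRABLE FORM AT A STAGE-12 PARAMETER WITH THE IDENTITY SELECTOR AND THE RESIDUALS OF RECORD, FROM (H-U) ALONE** — FILE 17's
`Stage9Params.rstepInt_of_localBg` with (H-ζ), the ζ-size law and the sign law supplied by K0b's residuals (K0c's assembly idiom: `hsel`, `hU`, `hres`).  No (H-h),
no (H-supp); the KEYED pointwise support form is not claimed. [cite: Balaban1989LargeFieldI, (0.3)–(0.4) p.176; Balaban1988Convergent, (2.17)–(2.18) p.257, (3.24)–(3.25) p.270 (bookkeeping)] -/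
theorem Stage12Params.rstepInt_of_localBg_of_residuals (θ : Stage12Params F N) (hsel : θ.ppSel = ppSelIdOfRecord F θ.ν θ.τ9.M)
    (hU : LocalBgMeasurable F N θ.ν) (hres : θ.HasResidualsOfRecord F N) : θ.toStage9Params.RStepInt :=
  θ.toStage9Params.rstepInt_of_localBg hsel hU (Stage12Params.zetaMeasurable_of_localBg_of_hasResidualsOfRecord hU hres) hres.zetaAbs
    (Stage12Params.zeta_nonneg_of_hasResidualsOfRecord hres)

end Residuals

/-! ## §2. K0a's live selector of record moves only dead sequences; row P6 (integrable form) at the live re-pin -/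

section LiveSel

variable {F N}

/-- **THE LIVE SELECTOR OF RECORD MOVES ONLY DEAD SEQUENCES** (FILE 17's dichotomy in its own currency): at every positive level `k + 1`, K0a's
`ppSelLiveOfRecord … (k + 1)` — the live selector of the pre-𝐑 family there (`ppSelLiveOfRecord_succ_eq`) — FIXES the sequence `s` (when `s` is live,
`liveSelOfSlot_of_live`), or `s` is DEAD: at every `V`, `(𝐓ρ_k)(s)(V) = 0` or `∫dV⌈_{Z′(s)} χ_{k+1}(s)·(𝐓ρ_k)(s) = 0 at V` (contrapositive of K0a's bridge
`liveSeq_of_ne_zero`, in the consumer's instance).  Generic in the numerics `ν`, `τ`, the normalisations `E` and the step weights `w`.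
[cite: Balaban1989LargeFieldI, (0.3) p.176 and p.177; Balaban1988Convergent, (3.22) p.269, (3.24)–(3.25) p.270 (bookkeeping)] -/
theorem ppSelLiveOfRecord_fixed_or_dead (ν : Stage7Numerics) (τ : TowerNumerics) (E : B12.RunParams → ℝ) (w : StepWeightsOfRecord F N ν τ.M)
    (p : B12.RunParams) (g : ℕ → ℝ) (k : ℕ) [iP : DecidableEq (PBond (F.P p.K) (k + 1))] (s : SeqOfRecord F ν τ.M g p.K (k + 1)) :
    ppSelLiveOfRecord F N ν τ E w p g (k + 1) s = s ∨
      ∀ V, slotsTOfRecord F N ν τ E w (ppSelLiveOfRecord F N ν τ E w) p g (k + 1) s V = 0 ∨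
        fibreIntegral (fibOfSeq F ν τ p g (k + 1) s)
          (fun V => chiSeqOfRecord F N ν τ.M g p.K (k + 1) s V *
            slotsTOfRecord F N ν τ E w (ppSelLiveOfRecord F N ν τ E w) p g (k + 1) s V) V = 0 := by
  by_cases hs : LiveSeq F N ν τ p g (k + 1) (slotsTOfRecord F N ν τ E w (ppSelLiveOfRecord F N ν τ E w) p g (k + 1)) s
  · left
    rw [ppSelLiveOfRecord_succ_eq]
    exact liveSelOfSlot_of_live F N hs
  · right
    intro V
    by_contra h
    push Not at h
    exact hs (liveSeq_of_ne_zero F N iP h.1 h.2)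

/-- **ROW P6 IN THE INTEGRABLE FORM AT ANY STAGE-9 PARAMETER WHOSE SELECTOR IS THE LIVE SELECTOR OF RECORD AT ITS OWN DATA**, from (H-U) ∧ (H-ζ) ∧ the
ζ-size law ∧ `0 ≤ ζ` (FILE 17's `rstepInt_of_localBg_of_sel` at the dichotomy above).
[cite: Balaban1989LargeFieldI, (0.3)–(0.4) p.176; Balaban1988Convergent, (2.17)–(2.18) p.257, (3.24)–(3.25) p.270 (bookkeeping)] -/
theorem Stage9Params.rstepInt_of_localBg_liveSel (θ : Stage9Params F N)
    (hsel : θ.ppSel = ppSelLiveOfRecord F N θ.ν θ.τ9 (EOfRecord₁₀ F N θ) (wOfRecord₉ F N θ))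
    (hU : LocalBgMeasurable F N θ.ν) (hζ : ZetaMeasurable F N θ.ζ) (hζa : IsZetaAbsLeOne F N θ.ν θ.τ9.M θ.ζ)
    (hζ0 : ∀ p g k s Pl Ql RS U V', 0 ≤ θ.ζ p g k s Pl Ql RS U V') : θ.RStepInt :=
  θ.rstepInt_of_localBg_of_sel hU hζ hζa hζ0 fun p k _ _ s => by
    rw [hsel]
    exact ppSelLiveOfRecord_fixed_or_dead θ.ν θ.τ9 (EOfRecord₁₀ F N θ) (wOfRecord₉ F N θ) p (gOfRecord₁₀ F N θ p) k s

/-- The live re-pin's Stage-9 selector IS the live selector of record at the re-pin's own data (K0a's `liveRepin_ppSel` with the selector-blind views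
`EOfRecord₁₀_liveRepin` ∕ `wOfRecord₉_liveRepin`; `rfl`). [cite: Balaban1989LargeFieldI, (0.3) p.176 (bookkeeping)] -/
theorem Stage12Params.liveRepin_toStage9Params_ppSel (θ : Stage12Params F N) :
    (θ.liveRepin F N).toStage9Params.ppSel =
      ppSelLiveOfRecord F N (θ.liveRepin F N).toStage9Params.ν (θ.liveRepin F N).toStage9Params.τ9
        (EOfRecord₁₀ F N (θ.liveRepin F N).toStage9Params) (wOfRecord₉ F N (θ.liveRepin F N).toStage9Params) := rfl

/-- **ROW P6 IN THE INTEGRABLE FORM AT THE LIVE RE-PIN OF ANY STAGE-12 PARAMETER** (director-ym LINE №114 (α); K0a's `Stage12Params.liveRepin`), from (H-U) ∧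
(H-ζ) ∧ the ζ-size law ∧ `0 ≤ ζ` — the re-pin keeps `ν`, `τ9`, `ζ` (`rfl`). [cite: Balaban1989LargeFieldI, (0.3)–(0.4) p.176 and p.177; Balaban1988Convergent, (2.17)–(2.18) p.257, (3.22) p.269, (3.24)–(3.25) p.270 (bookkeeping)] -/
theorem Stage12Params.rstepInt_liveRepin_of_localBg (θ : Stage12Params F N)
    (hU : LocalBgMeasurable F N θ.ν) (hζ : ZetaMeasurable F N θ.ζ) (hζa : IsZetaAbsLeOne F N θ.ν θ.τ9.M θ.ζ)
    (hζ0 : ∀ p g k s Pl Ql RS U V', 0 ≤ θ.ζ p g k s Pl Ql RS U V') : (θ.liveRepin F N).toStage9Params.RStepInt :=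
  (θ.liveRepin F N).toStage9Params.rstepInt_of_localBg_liveSel (Stage12Params.liveRepin_toStage9Params_ppSel θ) hU hζ hζa hζ0

/-- **… and from (H-U) ALONE when the parameter carries K0b's residuals of record** (`HasResidualsOfRecord` is selector-blind: K0a's `.liveRepin`).
[cite: Balaban1989LargeFieldI, (0.3)–(0.4) p.176; Balaban1988Convergent, (3.16) p.268, (3.21) p.269 (bookkeeping)] -/
theorem Stage12Params.rstepInt_liveRepin_of_localBg_of_residuals (θ : Stage12Params F N) (hU : LocalBgMeasurable F N θ.ν)
    (hres : θ.HasResidualsOfRecord F N) : (θ.liveRepin F N).toStage9Params.RStepInt :=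
  θ.rstepInt_liveRepin_of_localBg hU (Stage12Params.zetaMeasurable_of_localBg_of_hasResidualsOfRecord hU hres) hres.zetaAbs
    (Stage12Params.zeta_nonneg_of_hasResidualsOfRecord hres)

end LiveSel

/-! ## §3. The pins: row P6 (integrable form) at `θ₀` and at `θ₀ˡⁱᵛᵉ`, K0b's ζ of record, any residual objects, from (H-U) alone -/

section Pins

open scoped Matrix.Norms.L2Operator

variable {F N} (hU : LocalBgMeasurable F N numerics7OfRecord₁₂)
  (Rz : (K : ℕ) → Sect2.Residual (F.P K) (MatA N)) (Zt : (K : ℕ) → TkResidualW F N (FluctV N) K)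
include hU

/-- **ROW P6 (INTEGRABLE FORM) AT `θ₀ = theta12OfRecord F N (zeta316OfRecord … 1 1) Rz Zt`**, any `Rz`, `Zt`, from (H-U) alone: identity selector
(`theta12OfRecord_ppSel`), (H-ζ) by K0c's `zetaMeasurable_zeta316OfRecord_of_localBg`, the size ∕ sign laws by K0b (the companion of K0c's
`intPiece_theta12OfRecord` ∕ `measω_theta12OfRecord` ∕ `measChi_theta12OfRecord` for the 𝐑-row). [cite: Balaban1989LargeFieldI, (0.3)–(0.4) p.176; Balaban1988Convergent, (2.17)–(2.18) p.257, (3.16) p.268, (3.24)–(3.25) p.270 (bookkeeping)] -/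
theorem rstepInt_theta12OfRecord :
    (theta12OfRecord F N (zeta316OfRecord F N numerics7OfRecord₁₂ 1 1) Rz Zt).toStage9Params.RStepInt :=
  (theta12OfRecord F N (zeta316OfRecord F N numerics7OfRecord₁₂ 1 1) Rz Zt).toStage9Params.rstepInt_of_localBg rfl hU
    (zetaMeasurable_zeta316OfRecord_of_localBg hU 1 1) (isZetaAbsLeOne_zeta316OfRecord 1)
    fun p g k s Pl Ql RS U V' => zeta316OfRecord_nonneg 1 p g k s Pl Ql RS U V'

/-- **ROW P6 (INTEGRABLE FORM) AT THE LIVE RE-PIN `θ₀ˡⁱᵛᵉ = theta12LiveOfRecord F N (zeta316OfRecord … 1 1) Rz Zt`** (director-ym LINE №114 (α)), any `Rz`,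
`Zt`, from (H-U) alone (`theta12LiveOfRecord_eq`: `θ₀ˡⁱᵛᵉ = θ₀.liveRepin`, then §2). [cite: Balaban1989LargeFieldI, (0.3)–(0.4) p.176 and p.177; Balaban1988Convergent, (2.17)–(2.18) p.257, (3.16) p.268, (3.22) p.269, (3.24)–(3.25) p.270 (bookkeeping)] -/
theorem rstepInt_theta12LiveOfRecord :
    (theta12LiveOfRecord F N (zeta316OfRecord F N numerics7OfRecord₁₂ 1 1) Rz Zt).toStage9Params.RStepInt :=
  (theta12OfRecord F N (zeta316OfRecord F N numerics7OfRecord₁₂ 1 1) Rz Zt).rstepInt_liveRepin_of_localBg hU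
    (zetaMeasurable_zeta316OfRecord_of_localBg hU 1 1) (isZetaAbsLeOne_zeta316OfRecord 1)
    fun p g k s Pl Ql RS U V' => zeta316OfRecord_nonneg 1 p g k s Pl Ql RS U V'

end Pins

end Literature.MathematicalPhysics.QuantumFieldTheory.Balaban1983to89.Node00
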